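import Literature.MathematicalPhysics.QuantumFieldTheory.Balaban1983to89.Node00.AveragingSmooth
import Literature.MathematicalPhysics.QuantumFieldTheory.Balaban1983to89.B13CovarianceDifference216

/-!
# `Balaban1983to89.B15AveragingHolomorphic` — [Balaban1985Variational] = «[15]», Sect. G p. 307–309 ∕ Prop. 9 (190) p. 309; [Balaban1987RG1] = «[I]», (0.4) p. 253
# («we assume that it is an analytic function»); [Balaban1988Convergent] = «[III]», (2.14) p. 257:
# THE HOLOMORPHIC (ADJUGATE) MATRIX EXTENSION OF THE AVERAGING OF RECORD — a ℂ-differentiable map on `M_N(ℂ)`-valued configurations agreeing with `↑(Ū^k U)` on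
# small `SU(N)` fields

Honest framing: statement-level skeleton of published theorems with citation tags; proofs where landed; nothing here is a claim about the
Yang–Mills mass gap.  Cell `pub-ymgap`, HUMAN RULING D-0149 (width seats), seat `pub-ymgap-dag-n12-w1` (N12 = [B15]; W-SEAT-START-LIST §N12 item 1 = U1a;
U1A-CENSUS item (α)); count-neutral; N12 NOT discharged; finite 𝕋⁴ at fixed ε; nothing continuum ∕ OS ∕ mass-gap ∕ Clay.

WHY.  [15] Prop. 9 p. 309, verbatim: *«The minimal configuration U_k(V) … has an extension to an analytic function of Gᶜ-valued small configurations V′»*; p. 307: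
*«the equations … are valid for Gᶜ-valued fields»*; [I] p. 253 on the average `M({U_j})`: *«we assume that it is an analytic function»*.  The INTRINSIC analytic letter
(J0′) of the N12∕s1 endpoints (`B15Prop1JointHolomorphyFromMinimiserFamily`, this seat) asks for a family of bond MATRICES, ℂ-differentiable ENTRYWISE in the
complexified chart parameters, whose real members are (2.12) minimisers; its construction by the implicit-function mechanism (`Literature.Analysis.Calculus.
ConstrainedCriticalFamily`, this seat, over `𝕜 = ℂ`) needs the CONSTRAINT — the averaging of record `U ↦ Ū^k` ([I] (0.4), `Node00.avOfRecord = BlockAveraging.avgFun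
expMeanLogSU`) — as a ℂ-DIFFERENTIABLE map of `M_N(ℂ)`-valued configurations.  dag-n07-e's `Node00.AveragingSmooth` (p575068) built the REAL-smooth matrix extension
`holM ∕ avgM ∕ iterM` with ADJOINTS `V(b)⋆` on backward steps (`C^∞` over `ℝ`, not ℂ-differentiable: `⋆` is antilinear).  On `SU(N)` one has `U⋆ = U⁻¹ = adj U`
(`det U = 1`), and the adjugate is POLYNOMIAL in the entries; so replacing `⋆` by `adj` gives an extension that COINCIDES with n07-e's on `SU(N)` fields (hence with
the averaging of record on the small-field guard, by their `coe_avgFun_of_small` ∕ `coeField_iter_eq_iterM`) and is ℂ-differentiable wherever the (0.4) loop matrices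
lie in the polydisc `‖W − 1‖ < 1` of the analytic `exp[mean log]` (`ExpMeanLog.analyticAt_eml`, which IS `AnalyticAt ℂ`).

CONTENTS (`M = M_N(ℂ)` with the L2-operator norm of `Node00.AveragingSmooth`; fields `V : PBond P j → M`).
* §0 entry calculus on `M`: `differentiable_entry`, `differentiableAt_of_entries`, `differentiableAt_iff_entries` (ℂ-differentiability into `M` = entrywise),
  `differentiable_adjugate` (from the tree's `B13CovarianceDifference216.differentiableOn_matrix_adjugate`).
* §1 `stepMh`, ★ `holMh` (adjugate on backward steps); `adjugate_coe_eq_star` (`SU(N)`); `stepMh_coeField`, ★ `holMh_coeField` (`= holM` on `SU(N)` fields);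
  `differentiable_stepMh`, ★ `differentiable_holMh`.
* §2 `loopMh`, `axialMh`, `corrMh`, ★ `avgMh`; `loopMh_coeField`, `axialMh_coeField`, ★ `avgMh_coeField` (`= avgM`), ★ `coe_avgFun_eq_avgMh` (on the guard the matrix of
  `Ū(c)` IS `avgMh ↑U c`); ★★ `differentiableAt_avgMh` (at every field whose loop matrices lie in the polydisc), `differentiableAt_avgMh_coeField`.
* §3 ★ `iterMh`; ★ `iterMh_coeField_eq_iterM`, ★ `coeField_iter_eq_iterMh` (under n07-e's `SmallBelow`), ★★ `differentiableAt_iterMh`, ★★ `differentiableAt_iterMh_entry`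
  (the ENTRYWISE currency of (J0′)); at NODE 00's objects `coeField_avgFamily_eq_iterMh`, `differentiableAt_iterMh_avOfRecord`.
* §4 REAL STRUCTURE: `conjM_logOnePlus`, `conjM_mlog`, `conjM_eml`, `stepMh_conj`, ★ `holMh_conj`, ★★ `avgMh_conj`, ★★ `iterMh_conj` — entrywise complex conjugation
  commutes with the holomorphic extension on the polydisc (template for the symmetry input of `ConstrainedCriticalFamily.criticalFamily_equivariant`; the UNITARY real form
  needs the `θ(A) = (Aᴴ)⁻¹` edition — follow-up).
* §5 THE UNITARY REAL STRUCTURE `θ(A) = (A⋆)⁻¹`: `star_inv_mul_star_inv`, `adjugate_star_inv`, `mlog_star`, `isUnit_det_of_norm_sub_one_lt`, `mlog_star_inv`, `eml_star_inv`,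
  `stepMh_theta`, ★ `holMh_theta`, `isUnit_det_holMh`, `isUnit_det_avgMh`, ★★ `avgMh_theta`, ★★ `iterMh_theta` — `θ` commutes with the holomorphic averaging at
  invertible fields on the `1∕3`-polydisc (the symmetry input of `criticalFamily_equivariant` that makes a holomorphic critical family UNITARY on real parameters).
NOT here: the complexified exponential chart `z ↦ ↑U₀·exp(Σ_a z_a τ_a)` and its composition with `qsstarGIter0` ∕ the determining-set restriction (the N12-specific glue);
the positivity of the gauge-fixed Hessian; [15] Thm 1.  No estimate of print; no `instance`, no `sorry`.
-/

noncomputable section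

namespace Literature.MathematicalPhysics.QuantumFieldTheory.Balaban1983to89.B15AveragingHolomorphic

open Literature.MathematicalPhysics.QuantumFieldTheory.Balaban1983to89.Node00
  (SU avOfRecord coeField coeField_apply stepM holM holM_nil holM_cons loopM axialM corrM avgM iterM iterM_zero iterM_succ SmallBelow
   coe_avgFun_of_small coeField_iter_eq_iterM norm_loopM_coeField_sub_one_lt_one)
open T4Continuum BlockAveraging B15DeterminingSets
open ExpMeanLog (eml expMeanLogSU analyticAt_eml)
open B13CovarianceDifference216 (differentiableOn_matrix_adjugate)
open scoped Matrix.Norms.L2Operator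

/-! ## §0  Entry calculus on `M_N(ℂ)` (L2-operator norm): ℂ-differentiability into `M_N(ℂ)` is entrywise; the adjugate is ℂ-differentiable -/

section Entries

variable {N : ℕ} {X : Type*} [NormedAddCommGroup X] [NormedSpace ℂ X]

/-- An entry `A ↦ A i j` is a ℂ-linear map of the finite-dimensional space `M_N(ℂ)`, hence ℂ-differentiable. [cite: Balaban1987RG1, p.253 («analytic function»; bookkeeping)] -/
theorem differentiable_entry (i j : Fin N) : Differentiable ℂ (fun A : Matrix (Fin N) (Fin N) ℂ => A i j) :=
  (LinearMap.toContinuousLinearMap (Matrix.entryLinearMap ℂ ℂ i j)).differentiable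

/-- The entries of a ℂ-differentiable matrix-valued map are ℂ-differentiable. [cite: Balaban1987RG1, p.253 («analytic function»; bookkeeping)] -/
theorem differentiableAt_entry_of {f : X → Matrix (Fin N) (Fin N) ℂ} {x : X} (hf : DifferentiableAt ℂ f x) (i j : Fin N) :
    DifferentiableAt ℂ (fun y => f y i j) x :=
  ((differentiable_entry i j) (f x)).comp x hf

/-- A matrix-valued map with ℂ-differentiable entries is ℂ-differentiable (`A = Σ_{ij} A_{ij}·E_{ij}`). [cite: Balaban1987RG1, p.253 («analytic function»; bookkeeping)] -/
theorem differentiableAt_of_entries {f : X → Matrix (Fin N) (Fin N) ℂ} {x : X} (hf : ∀ i j, DifferentiableAt ℂ (fun y => f y i j) x) :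
    DifferentiableAt ℂ f x := by
  have heq : f = fun y => ∑ i : Fin N, ∑ j : Fin N, f y i j • Matrix.single i j (1 : ℂ) := by
    funext y
    conv_lhs => rw [Matrix.matrix_eq_sum_single (f y)]
    refine Finset.sum_congr rfl fun i _ => Finset.sum_congr rfl fun j _ => ?_
    rw [Matrix.smul_single, smul_eq_mul, mul_one]
  rw [heq]
  exact DifferentiableAt.fun_sum fun i _ => DifferentiableAt.fun_sum fun j _ => (hf i j).smul_const _

/-- ℂ-differentiability into `M_N(ℂ)` ⟺ entrywise ℂ-differentiability. [cite: Balaban1987RG1, p.253 («analytic function»; bookkeeping)] -/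
theorem differentiableAt_iff_entries {f : X → Matrix (Fin N) (Fin N) ℂ} {x : X} :
    DifferentiableAt ℂ f x ↔ ∀ i j, DifferentiableAt ℂ (fun y => f y i j) x :=
  ⟨fun h => differentiableAt_entry_of h, differentiableAt_of_entries⟩

/-- **THE ADJUGATE IS ℂ-DIFFERENTIABLE ON `M_N(ℂ)`** (polynomial entries; the tree's `B13CovarianceDifference216.differentiableOn_matrix_adjugate`).
[cite: Balaban1985Variational, p.307 («valid for Gᶜ-valued fields»; bookkeeping)] -/
theorem differentiable_adjugate : Differentiable ℂ (fun A : Matrix (Fin N) (Fin N) ℂ => A.adjugate) := fun A₀ =>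
  differentiableAt_of_entries (x := A₀) fun i j =>
    (differentiableOn_matrix_adjugate (A := fun B : Matrix (Fin N) (Fin N) ℂ => B) (s := Set.univ)
      (fun a c => (differentiable_entry a c).differentiableOn) i j).differentiableAt Filter.univ_mem

end Entries

/-! ## §1  Walk products with ADJUGATES on backward steps -/

section Walks

variable {P : Params} {j : ℕ} {N : ℕ}

/-- The HOLOMORPHIC step matrix: `V(b)` forward, `adj V(b)` backward (on `SU(N)`: `adj U = U⋆ = U⁻¹`). [cite: Balaban1985Variational, p.307 («valid for Gᶜ-valued fields»); Balaban1987RG1, (0.4) p.253] -/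
def stepMh (V : PBond P j → Matrix (Fin N) (Fin N) ℂ) (s : LStep P j) : Matrix (Fin N) (Fin N) ℂ :=
  if s.fwd then V s.bond else (V s.bond).adjugate

/-- ★ **THE HOLOMORPHIC WALK PRODUCT**: the ordered product of the holomorphic step matrices. [cite: Balaban1985Variational, p.307; Balaban1987RG1, (0.4) p.253] -/
def holMh (V : PBond P j → Matrix (Fin N) (Fin N) ℂ) (γ : List (LStep P j)) : Matrix (Fin N) (Fin N) ℂ := (γ.map (stepMh V)).prod

/-- `holMh V [] = 1`. [cite: Balaban1987RG1, (0.4) p.253 (bookkeeping)] -/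
@[simp] theorem holMh_nil (V : PBond P j → Matrix (Fin N) (Fin N) ℂ) : holMh V [] = 1 := by simp [holMh]

/-- `holMh V (s :: γ) = stepMh V s · holMh V γ`. [cite: Balaban1987RG1, (0.4) p.253 (bookkeeping)] -/
theorem holMh_cons (V : PBond P j → Matrix (Fin N) (Fin N) ℂ) (s : LStep P j) (γ : List (LStep P j)) :
    holMh V (s :: γ) = stepMh V s * holMh V γ := by
  simp [holMh]

/-- **ON `SU(N)` THE ADJUGATE IS THE ADJOINT**: `adj ↑g = (↑g)⋆` for `g ∈ SU(N)` (`adj g · g = det g • 1 = 1` and `g⋆ · g = 1`, so both are THE inverse of `↑g`).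
[cite: Balaban1985Variational, p.307 («valid for Gᶜ-valued fields»; bookkeeping)] -/
theorem adjugate_coe_eq_star (g : SU N) : (g : Matrix (Fin N) (Fin N) ℂ).adjugate = star (g : Matrix (Fin N) (Fin N) ℂ) := by
  have hdet : (g : Matrix (Fin N) (Fin N) ℂ).det = 1 := (Matrix.mem_specialUnitaryGroup_iff.1 g.2).2
  have hadj : (g : Matrix (Fin N) (Fin N) ℂ).adjugate * (g : Matrix (Fin N) (Fin N) ℂ) = 1 := by
    rw [Matrix.adjugate_mul, hdet, one_smul]
  have hstar : (g : Matrix (Fin N) (Fin N) ℂ) * star (g : Matrix (Fin N) (Fin N) ℂ) = 1 :=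
    (Matrix.mem_unitaryGroup_iff).1 (Matrix.mem_specialUnitaryGroup_iff.1 g.2).1
  calc (g : Matrix (Fin N) (Fin N) ℂ).adjugate
      = (g : Matrix (Fin N) (Fin N) ℂ).adjugate * ((g : Matrix (Fin N) (Fin N) ℂ) * star (g : Matrix (Fin N) (Fin N) ℂ)) := by rw [hstar, mul_one]
    _ = star (g : Matrix (Fin N) (Fin N) ℂ) := by rw [← mul_assoc, hadj, one_mul]

/-- On an `SU(N)` field the holomorphic step matrix IS n07-e's step matrix. [cite: Balaban1987RG1, (0.4) p.253 (bookkeeping)] -/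
theorem stepMh_coeField (U : GaugeField P j (SU N)) (s : LStep P j) : stepMh (coeField U) s = stepM (coeField U) s := by
  unfold stepMh stepM
  split_ifs with h
  · rfl
  · rw [coeField_apply, adjugate_coe_eq_star]

/-- ★ **ON `SU(N)` FIELDS THE HOLOMORPHIC WALK PRODUCT IS n07-e's WALK PRODUCT** (hence the matrix of the tree's holonomy, `Node00.coe_holAt`). [cite: Balaban1987RG1, (0.4) p.253] -/
theorem holMh_coeField (U : GaugeField P j (SU N)) : ∀ γ : List (LStep P j), holMh (coeField U) γ = holM (coeField U) γ
  | [] => by rw [holMh_nil, holM_nil]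
  | s :: γ => by rw [holMh_cons, holM_cons, stepMh_coeField, holMh_coeField U γ]

/-- A holomorphic step matrix is a ℂ-differentiable function of the field (evaluation, possibly followed by the polynomial adjugate). [cite: Balaban1985Variational, p.307 (bookkeeping)] -/
theorem differentiable_stepMh (s : LStep P j) : Differentiable ℂ (fun V : PBond P j → Matrix (Fin N) (Fin N) ℂ => stepMh V s) := by
  have hev : Differentiable ℂ (fun V : PBond P j → Matrix (Fin N) (Fin N) ℂ => V s.bond) :=
    (ContinuousLinearMap.proj (R := ℂ) (φ := fun _ : PBond P j => Matrix (Fin N) (Fin N) ℂ) s.bond).differentiable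
  unfold stepMh
  by_cases h : s.fwd
  · simp only [h, if_true]
    exact hev
  · simp only [h]
    exact differentiable_adjugate.comp hev

/-- ★ **HOLOMORPHIC WALK PRODUCTS ARE ℂ-DIFFERENTIABLE** (finite products in the normed algebra `M_N(ℂ)`). [cite: Balaban1985Variational, p.307; Balaban1987RG1, p.253 («analytic function»)] -/
theorem differentiable_holMh : ∀ γ : List (LStep P j), Differentiable ℂ (fun V : PBond P j → Matrix (Fin N) (Fin N) ℂ => holMh V γ)
  | [] => by
    simp only [holMh_nil]
    exact differentiable_const _
  | s :: γ => by
    simp only [holMh_cons]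
    exact (differentiable_stepMh s).mul (differentiable_holMh γ)

end Walks

/-! ## §2  The one-step averaging (0.4) as a HOLOMORPHIC matrix map -/

section OneStep

variable {P : Params} {j : ℕ} {N : ℕ}

/-- The (0.4) loop matrices, holomorphic edition. [cite: Balaban1987RG1, (0.4) p.253] -/
def loopMh (V : PBond P j → Matrix (Fin N) (Fin N) ℂ) (c : PBond P (j + 1)) (i : Idx P) : Matrix (Fin N) (Fin N) ℂ :=
  holMh V (walk (emb c.src) (loopWord P.L c.dir (off i.1) i.2.1 i.2.2))

/-- The straight-segment matrix, holomorphic edition. [cite: Balaban1987RG1, (0.4) p.253] -/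
def axialMh (V : PBond P j → Matrix (Fin N) (Fin N) ℂ) (c : PBond P (j + 1)) : Matrix (Fin N) (Fin N) ℂ :=
  holMh V (walk (emb c.src) (List.replicate P.L (c.dir, true)))

/-- The unguarded correction factor `exp[|I|⁻¹ Σ_i log V(loop_i)]`, holomorphic edition. [cite: Balaban1987RG1, (0.4) p.253] -/
def corrMh (V : PBond P j → Matrix (Fin N) (Fin N) ℂ) (c : PBond P (j + 1)) : Matrix (Fin N) (Fin N) ℂ :=
  eml fun i : Idx P => loopMh V c i

/-- ★ **THE HOLOMORPHIC MATRIX EXTENSION OF THE AVERAGING OF RECORD (0.4)**: `avgMh V c = exp[|I|⁻¹ Σ_i log V(loop_i)] · V([c₋, c₊])` with adjugates on backward steps.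
[cite: Balaban1987RG1, (0.4) p.253; Balaban1985Variational, p.307] -/
def avgMh (V : PBond P j → Matrix (Fin N) (Fin N) ℂ) : PBond P (j + 1) → Matrix (Fin N) (Fin N) ℂ := fun c => corrMh V c * axialMh V c

/-- On `SU(N)` fields: `loopMh ↑U = loopM ↑U`. [cite: Balaban1987RG1, (0.4) p.253 (bookkeeping)] -/
theorem loopMh_coeField (U : GaugeField P j (SU N)) (c : PBond P (j + 1)) (i : Idx P) :
    loopMh (coeField U) c i = loopM (coeField U) c i :=
  holMh_coeField U _

/-- On `SU(N)` fields: `axialMh ↑U = axialM ↑U`. [cite: Balaban1987RG1, (0.4) p.253 (bookkeeping)] -/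
theorem axialMh_coeField (U : GaugeField P j (SU N)) (c : PBond P (j + 1)) : axialMh (coeField U) c = axialM (coeField U) c :=
  holMh_coeField U _

/-- ★ **ON `SU(N)` FIELDS THE HOLOMORPHIC EXTENSION IS n07-e's REAL-SMOOTH EXTENSION**: `avgMh ↑U = avgM ↑U`. [cite: Balaban1987RG1, (0.4) p.253] -/
theorem avgMh_coeField (U : GaugeField P j (SU N)) : avgMh (coeField U) = avgM (coeField U) := by
  funext c
  have hl : (fun i : Idx P => loopMh (coeField U) c i) = fun i => loopM (coeField U) c i := funext fun i => loopMh_coeField U c i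
  show eml (fun i : Idx P => loopMh (coeField U) c i) * axialMh (coeField U) c = eml (fun i : Idx P => loopM (coeField U) c i) * axialM (coeField U) c
  rw [hl, axialMh_coeField]

variable [NeZero N] in
/-- ★ **ON THE GUARD THE MATRIX OF `Ū(c)` IS `avgMh ↑U c`** — the holomorphic extension agrees with the averaging of record `BlockAveraging.avgFun expMeanLogSU`
(= `Node00.avOfRecord`) at every small-field configuration (n07-e's `coe_avgFun_of_small` + `avgMh_coeField`). [cite: Balaban1987RG1, (0.4) p.253] -/
theorem coe_avgFun_eq_avgMh (U : GaugeField P j (SU N)) (c : PBond P (j + 1)) (h : Small expMeanLogSU U c) :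
    ((avgFun expMeanLogSU U c : SU N) : Matrix (Fin N) (Fin N) ℂ) = avgMh (coeField U) c := by
  rw [avgMh_coeField]
  exact coe_avgFun_of_small U c h

/-- ★★ **THE HOLOMORPHIC EXTENSION IS ℂ-DIFFERENTIABLE AT EVERY FIELD WHOSE (0.4) LOOP MATRICES LIE IN THE POLYDISC `‖W − 1‖ < 1`** (holomorphic loop ∕ segment products,
the ℂ-ANALYTIC `exp[mean log]` `ExpMeanLog.analyticAt_eml`, products in `M_N(ℂ)`). [cite: Balaban1987RG1, (0.4) p.253 («we assume that it is an analytic function»); Balaban1985Variational, Prop. 9 p.309] -/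
theorem differentiableAt_avgMh {V₀ : PBond P j → Matrix (Fin N) (Fin N) ℂ} (h : ∀ (c : PBond P (j + 1)) (i : Idx P), ‖loopMh V₀ c i - 1‖ < 1) :
    DifferentiableAt ℂ (avgMh : (PBond P j → Matrix (Fin N) (Fin N) ℂ) → PBond P (j + 1) → Matrix (Fin N) (Fin N) ℂ) V₀ := by
  refine differentiableAt_pi.2 fun c => ?_
  have hin : DifferentiableAt ℂ (fun V : PBond P j → Matrix (Fin N) (Fin N) ℂ => fun i : Idx P => loopMh V c i) V₀ :=
    differentiableAt_pi.2 fun i => (differentiable_holMh _ ) V₀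
  have heml : DifferentiableAt ℂ (eml : (Idx P → Matrix (Fin N) (Fin N) ℂ) → Matrix (Fin N) (Fin N) ℂ) (fun i => loopMh V₀ c i) :=
    (analyticAt_eml (𝔸 := Matrix (Fin N) (Fin N) ℂ) (h c)).differentiableAt
  have hcorr : DifferentiableAt ℂ (fun V : PBond P j → Matrix (Fin N) (Fin N) ℂ => corrMh V c) V₀ := heml.comp V₀ hin
  exact hcorr.mul ((differentiable_holMh _) V₀)

variable [NeZero N] in
/-- The polydisc hypothesis at `↑U` from the small-field guard at every coarse bond (n07-e's `norm_loopM_coeField_sub_one_lt_one`), hence ℂ-differentiability of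
`avgMh` at `↑U`. [cite: Balaban1987RG1, (0.4) p.253] -/
theorem differentiableAt_avgMh_coeField {U : GaugeField P j (SU N)} (h : ∀ c : PBond P (j + 1), Small expMeanLogSU U c) :
    DifferentiableAt ℂ (avgMh : (PBond P j → Matrix (Fin N) (Fin N) ℂ) → PBond P (j + 1) → Matrix (Fin N) (Fin N) ℂ) (coeField U) :=
  differentiableAt_avgMh fun c i => by
    rw [loopMh_coeField]
    exact norm_loopM_coeField_sub_one_lt_one U c (h c) i

end OneStep

/-! ## §3  The `k`-fold iterate, holomorphic edition -/

section Iterate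

variable {P : Params} {N : ℕ}

/-- ★ **THE ITERATED HOLOMORPHIC AVERAGING** from level `0` to level `k`. [cite: Balaban1987RG1, (0.21) p.256; Balaban1988Convergent, (2.14) p.257] -/
def iterMh : (k : ℕ) → (PBond P 0 → Matrix (Fin N) (Fin N) ℂ) → (PBond P k → Matrix (Fin N) (Fin N) ℂ)
  | 0 => id
  | k + 1 => fun V => avgMh (iterMh k V)

/-- `iterMh 0 = id`. [cite: Balaban1987RG1, (0.21) p.256 (bookkeeping)] -/
@[simp] theorem iterMh_zero (V : PBond P 0 → Matrix (Fin N) (Fin N) ℂ) : iterMh 0 V = V := rfl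

/-- `iterMh (k+1) V = avgMh (iterMh k V)`. [cite: Balaban1987RG1, (0.21) p.256 (bookkeeping)] -/
theorem iterMh_succ (k : ℕ) (V : PBond P 0 → Matrix (Fin N) (Fin N) ℂ) : iterMh (k + 1) V = avgMh (iterMh k V) := rfl

variable [NeZero N]

/-- ★ **UNDER THE GUARD BELOW `k` THE HOLOMORPHIC ITERATE AT `↑U` IS n07-e's ITERATE** (`= ↑(Ū^k U)` by their `coeField_iter_eq_iterM`). [cite: Balaban1987RG1, (0.4) p.253, (0.21) p.256] -/
theorem iterMh_coeField_eq_iterM {U : GaugeField P 0 (SU N)} :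
    ∀ k, SmallBelow (fun j => blockAvg (P := P) (j := j) expMeanLogSU) k U → iterMh k (coeField U) = iterM k (coeField U)
  | 0, _ => rfl
  | k + 1, h => by
    have ih := iterMh_coeField_eq_iterM k (h.mono (Nat.le_succ k))
    rw [iterMh_succ, iterM_succ, ih, ← coeField_iter_eq_iterM k (h.mono (Nat.le_succ k)), avgMh_coeField]

/-- ★ **UNDER THE GUARD BELOW `k`, `↑(Ū^k U) = iterMh k ↑U`.** [cite: Balaban1987RG1, (0.4) p.253, (0.21) p.256] -/
theorem coeField_iter_eq_iterMh {U : GaugeField P 0 (SU N)} (k : ℕ) (h : SmallBelow (fun j => blockAvg (P := P) (j := j) expMeanLogSU) k U) :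
    coeField (Averaging.iter (fun j => blockAvg (P := P) (j := j) expMeanLogSU) k U) = iterMh k (coeField U) := by
  rw [iterMh_coeField_eq_iterM k h, coeField_iter_eq_iterM k h]

/-- ★★ **THE HOLOMORPHIC ITERATE IS ℂ-DIFFERENTIABLE AT `↑U` UNDER THE GUARD BELOW `k`** (induction: `avgMh` is ℂ-differentiable at `iterMh j ↑U = ↑(Ū^j U)`, whose loop
matrices are in the polydisc by the guard at level `j`). [cite: Balaban1987RG1, (0.4) p.253 («analytic function»), (0.21) p.256; Balaban1985Variational, Prop. 9 p.309] -/
theorem differentiableAt_iterMh {U : GaugeField P 0 (SU N)} :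
    ∀ k, SmallBelow (fun j => blockAvg (P := P) (j := j) expMeanLogSU) k U →
      DifferentiableAt ℂ (iterMh k : (PBond P 0 → Matrix (Fin N) (Fin N) ℂ) → PBond P k → Matrix (Fin N) (Fin N) ℂ) (coeField U)
  | 0, _ => differentiableAt_id
  | k + 1, h => by
    have ih := differentiableAt_iterMh k (h.mono (Nat.le_succ k))
    have hk : DifferentiableAt ℂ (avgMh : (PBond P k → Matrix (Fin N) (Fin N) ℂ) → PBond P (k + 1) → Matrix (Fin N) (Fin N) ℂ)
        (iterMh k (coeField U)) := by
      rw [← coeField_iter_eq_iterMh k (h.mono (Nat.le_succ k))]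
      exact differentiableAt_avgMh_coeField fun c => h k (Nat.lt_succ_self k) c
    exact hk.comp (coeField U) ih

/-- ★★ **ENTRYWISE CURRENCY** (the shape of the N12 letter (J0′)): along any map `V : X → (PBond P 0 → M_N(ℂ))` ℂ-differentiable at `x` with `V x = ↑U`, `U` guarded below
`k`, every entry `y ↦ iterMh k (V y) b a c` is ℂ-differentiable at `x`. [cite: Balaban1985Variational, Prop. 9 (190) p.309; Balaban1987RG1, (0.4) p.253] -/
theorem differentiableAt_iterMh_entry {X : Type*} [NormedAddCommGroup X] [NormedSpace ℂ X] {U : GaugeField P 0 (SU N)} {k : ℕ}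
    (hU : SmallBelow (fun j => blockAvg (P := P) (j := j) expMeanLogSU) k U) {V : X → PBond P 0 → Matrix (Fin N) (Fin N) ℂ} {x : X}
    (hV : DifferentiableAt ℂ V x) (hx : V x = coeField U) (b : PBond P k) (a c : Fin N) :
    DifferentiableAt ℂ (fun y => iterMh k (V y) b a c) x := by
  have h1 : DifferentiableAt ℂ (iterMh k : (PBond P 0 → Matrix (Fin N) (Fin N) ℂ) → PBond P k → Matrix (Fin N) (Fin N) ℂ) (V x) := by
    rw [hx]; exact differentiableAt_iterMh k hU
  have h2 : DifferentiableAt ℂ (fun y => iterMh k (V y)) x := h1.comp x hV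
  have h3 : DifferentiableAt ℂ (fun y => iterMh k (V y) b) x := (differentiableAt_pi.1 h2) b
  exact differentiableAt_entry_of h3 a c

end Iterate

/-! ### At NODE 00's objects (`avOfRecord F N K j = blockAvg expMeanLogSU`, `rfl`) -/

section Record

variable {F : T4Family} {N : ℕ} [NeZero N]

/-- At the objects of record: under the guard below `k`, `↑(Ū^k U) = iterMh k ↑U` for `avgFamily (avOfRecord F N K)`. [cite: Balaban1987RG1, (0.4) p.253, (0.21) p.256; Balaban1988Convergent, (2.11) p.256] -/
theorem coeField_avgFamily_eq_iterMh {K k : ℕ} {U : GaugeField (F.P K) 0 (SU N)} (h : SmallBelow (avOfRecord F N K) k U) :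
    coeField (avgFamily (avOfRecord F N K) U k) = iterMh k (coeField U) :=
  coeField_iter_eq_iterMh k h

/-- At the objects of record: `iterMh k` is ℂ-differentiable at `↑U` under the guard below `k`. [cite: Balaban1987RG1, (0.4) p.253, (0.21) p.256; Balaban1985Variational, Prop. 9 p.309] -/
theorem differentiableAt_iterMh_avOfRecord {K k : ℕ} {U : GaugeField (F.P K) 0 (SU N)} (h : SmallBelow (avOfRecord F N K) k U) :
    DifferentiableAt ℂ (iterMh k : (PBond (F.P K) 0 → Matrix (Fin N) (Fin N) ℂ) → PBond (F.P K) k → Matrix (Fin N) (Fin N) ℂ) (coeField U) :=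
  differentiableAt_iterMh k h

end Record

/-! ## §4  Real structure (entrywise): the holomorphic extension commutes with ENTRYWISE COMPLEX CONJUGATION

This is the template for the symmetry input of `Literature.Analysis.Calculus.ConstrainedCriticalFamily.criticalFamily_equivariant`.  CAUTION: the anti-holomorphic
involution whose fixed set in `SL_N(ℂ)` is `SU(N)` is `θ(A) = (Aᴴ)⁻¹` (in exponential coordinates `z ↦ U₀·exp(Σ z_a τ_a)` it is coordinatewise conjugation), not the
entrywise conjugation of this section (which fixes real matrices); the `θ`-edition of these lemmas (θ multiplicative, commuting with `adj`, `mlog((Bᴴ)⁻¹) = −(mlog B)ᴴ`) is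
the follow-up that makes a holomorphic critical family UNITARY on real parameters. -/

section Conj

variable {P : Params} {j : ℕ} {N : ℕ}

open Literature.Analysis.Complex (logOnePlus logSeriesCoeff hasSum_logOnePlus)
open MatrixLog (mlog mlog_def)

/-- Entrywise complex conjugation of `M_N(ℂ)` as a ring homomorphism (`(starRingEnd ℂ).mapMatrix`). [cite: Balaban1985Variational, p.307 («Gᶜ-valued fields»; bookkeeping)] -/
theorem conjM_apply (A : Matrix (Fin N) (Fin N) ℂ) (a c : Fin N) : (starRingEnd ℂ).mapMatrix A a c = starRingEnd ℂ (A a c) := rfl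

/-- Entrywise conjugation is continuous. [cite: Balaban1985Variational, p.307 (bookkeeping)] -/
theorem continuous_conjM : Continuous ((starRingEnd ℂ).mapMatrix : Matrix (Fin N) (Fin N) ℂ → Matrix (Fin N) (Fin N) ℂ) :=
  continuous_id.matrix_map RCLike.continuous_conj

/-- Entrywise conjugation is conjugate-linear for complex scalars: `conj (z • A) = conj z • conj A`. [cite: Balaban1985Variational, p.307 (bookkeeping)] -/
theorem conjM_smul (z : ℂ) (A : Matrix (Fin N) (Fin N) ℂ) :
    (starRingEnd ℂ).mapMatrix (z • A) = starRingEnd ℂ z • (starRingEnd ℂ).mapMatrix A := by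
  ext a c
  simp [Matrix.smul_apply]

/-- **CONJUGATION COMMUTES WITH THE LOGARITHMIC SERIES** on its disc: the coefficients `(−1)^{n+1}/n` are real. [cite: Balaban1985Averaging, (21) p.21 (bookkeeping)] -/
theorem conjM_logOnePlus {Y : Matrix (Fin N) (Fin N) ℂ} (hY : ‖Y‖ < 1) :
    (starRingEnd ℂ).mapMatrix (logOnePlus Y) = logOnePlus ((starRingEnd ℂ).mapMatrix Y) := by
  have h := (hasSum_logOnePlus hY).map ((starRingEnd ℂ).mapMatrix : Matrix (Fin N) (Fin N) ℂ →+* Matrix (Fin N) (Fin N) ℂ)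
    continuous_conjM
  have hterm : ((starRingEnd ℂ).mapMatrix : Matrix (Fin N) (Fin N) ℂ →+* Matrix (Fin N) (Fin N) ℂ) ∘ (fun n : ℕ => logSeriesCoeff n • Y ^ n) =
      fun n : ℕ => logSeriesCoeff n • ((starRingEnd ℂ).mapMatrix Y) ^ n := by
    funext n
    simp only [Function.comp_apply, conjM_smul, map_pow]
    congr 1
    simp [Literature.Analysis.Complex.logSeriesCoeff, map_div₀]
  rw [hterm] at h
  exact (h.tsum_eq).symm

/-- **CONJUGATION COMMUTES WITH THE MATRIX LOGARITHM (21)** on `‖X − 1‖ < 1`. [cite: Balaban1985Averaging, (21) p.21 (bookkeeping)] -/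
theorem conjM_mlog {X : Matrix (Fin N) (Fin N) ℂ} (hX : ‖X - 1‖ < 1) :
    (starRingEnd ℂ).mapMatrix (mlog X) = mlog ((starRingEnd ℂ).mapMatrix X) := by
  rw [mlog_def, mlog_def, conjM_logOnePlus hX, map_sub, map_one]

/-- **CONJUGATION COMMUTES WITH THE `exp[mean log]` OF (0.4)** on the polydisc (continuous ring homomorphisms commute with `exp`; the weight `|I|⁻¹` is real).
[cite: Balaban1987RG1, (0.4) p.253 (bookkeeping)] -/
theorem conjM_eml {ι : Type*} [Fintype ι] {W : ι → Matrix (Fin N) (Fin N) ℂ} (hW : ∀ i, ‖W i - 1‖ < 1) :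
    (starRingEnd ℂ).mapMatrix (eml W) = eml fun i => (starRingEnd ℂ).mapMatrix (W i) := by
  have hball : ((Fintype.card ι : ℂ))⁻¹ • ∑ i, mlog (W i) ∈ Metric.eball (0 : Matrix (Fin N) (Fin N) ℂ) (NormedSpace.expSeries ℂ (Matrix (Fin N) (Fin N) ℂ)).radius := by
    rw [NormedSpace.expSeries_radius_eq_top]; exact edist_lt_top _ _
  rw [ExpMeanLog.eml_eq_exp, ExpMeanLog.eml_eq_exp,
    NormedSpace.map_exp_of_mem_ball (𝕂 := ℂ) ((starRingEnd ℂ).mapMatrix : Matrix (Fin N) (Fin N) ℂ →+* Matrix (Fin N) (Fin N) ℂ) continuous_conjM _ hball,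
    conjM_smul, map_sum]
  have hc : starRingEnd ℂ ((Fintype.card ι : ℂ))⁻¹ = ((Fintype.card ι : ℂ))⁻¹ := by simp
  rw [hc, Finset.sum_congr rfl fun i _ => conjM_mlog (hW i)]

/-- Conjugation of a bond-matrix field, bondwise. [cite: Balaban1985Variational, p.307 (bookkeeping)] -/
theorem stepMh_conj (V : PBond P j → Matrix (Fin N) (Fin N) ℂ) (s : LStep P j) :
    stepMh (fun b => (starRingEnd ℂ).mapMatrix (V b)) s = (starRingEnd ℂ).mapMatrix (stepMh V s) := by
  unfold stepMh
  split_ifs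
  · rfl
  · exact (RingHom.map_adjugate _ _).symm

/-- ★ **CONJUGATION COMMUTES WITH THE HOLOMORPHIC WALK PRODUCTS** (ring homomorphism through products and adjugates). [cite: Balaban1985Variational, p.307 («Gᶜ-valued fields»)] -/
theorem holMh_conj (V : PBond P j → Matrix (Fin N) (Fin N) ℂ) : ∀ γ : List (LStep P j),
    holMh (fun b => (starRingEnd ℂ).mapMatrix (V b)) γ = (starRingEnd ℂ).mapMatrix (holMh V γ)
  | [] => by rw [holMh_nil, holMh_nil, map_one]
  | s :: γ => by rw [holMh_cons, holMh_cons, map_mul, stepMh_conj, holMh_conj V γ]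

/-- ★★ **CONJUGATION COMMUTES WITH THE HOLOMORPHIC AVERAGING** at every field whose (0.4) loop matrices lie in the polydisc `‖W − 1‖ < 1`:
`avgMh (conj ∘ V) = conj ∘ avgMh V`. [cite: Balaban1987RG1, (0.4) p.253; Balaban1985Variational, p.307] -/
theorem avgMh_conj {V : PBond P j → Matrix (Fin N) (Fin N) ℂ} (h : ∀ (c : PBond P (j + 1)) (i : Idx P), ‖loopMh V c i - 1‖ < 1) :
    avgMh (fun b => (starRingEnd ℂ).mapMatrix (V b)) = fun c => (starRingEnd ℂ).mapMatrix (avgMh V c) := by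
  funext c
  show eml (fun i : Idx P => loopMh (fun b => (starRingEnd ℂ).mapMatrix (V b)) c i) * axialMh (fun b => (starRingEnd ℂ).mapMatrix (V b)) c =
    (starRingEnd ℂ).mapMatrix (eml (fun i : Idx P => loopMh V c i) * axialMh V c)
  have hl : (fun i : Idx P => loopMh (fun b => (starRingEnd ℂ).mapMatrix (V b)) c i) = fun i => (starRingEnd ℂ).mapMatrix (loopMh V c i) :=
    funext fun i => holMh_conj V _
  rw [map_mul, hl, conjM_eml (h c), show axialMh (fun b => (starRingEnd ℂ).mapMatrix (V b)) c = (starRingEnd ℂ).mapMatrix (axialMh V c) from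
    holMh_conj V _]

/-- ★★ **CONJUGATION COMMUTES WITH THE HOLOMORPHIC ITERATE** under the polydisc condition at every level `< k` along the iterates of `V`.
[cite: Balaban1987RG1, (0.21) p.256; Balaban1985Variational, p.307] -/
theorem iterMh_conj {V : PBond P 0 → Matrix (Fin N) (Fin N) ℂ} :
    ∀ k, (∀ j', j' < k → ∀ (c : PBond P (j' + 1)) (i : Idx P), ‖loopMh (iterMh j' V) c i - 1‖ < 1) →
      iterMh k (fun b => (starRingEnd ℂ).mapMatrix (V b)) = fun b => (starRingEnd ℂ).mapMatrix (iterMh k V b)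
  | 0, _ => rfl
  | k + 1, h => by
    rw [iterMh_succ, iterMh_succ, iterMh_conj k fun j' hj' => h j' (Nat.lt_succ_of_lt hj')]
    exact avgMh_conj (h k (Nat.lt_succ_self k))

end Conj

/-! ## §5  The UNITARY real structure `θ(A) = (A⋆)⁻¹`: through products, adjugates, the logarithm (21), the `exp[mean log]` of (0.4), and the holomorphic averaging

The anti-holomorphic involution of `GL_N(ℂ)` whose fixed points of determinant `1` are exactly `SU(N)`; in exponential coordinates `z ↦ U₀·exp(Σ z_a τ_a)` (`τ_a⋆ = −τ_a`,
`U₀ ∈ SU(N)`) it is coordinatewise conjugation.  With `Literature.Analysis.Calculus.ConstrainedCriticalFamily.criticalFamily_equivariant` (σ = θ) these lemmas are the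
symmetry input making a holomorphic critical family of the complexified (2.12) problem UNITARY at real parameters. -/

section Theta

open NormedSpace (exp)
open ExpMeanLog (eml_eq_exp mlog_eq_neg_of_mul_eq_one norm_mlog_lt_log_two norm_star_sub_one)
open MatrixLog (mlog exp_mlog)
open B7BlockAvgLog (mlog_exp)

variable {N : ℕ}

/-- **`θ` IS MULTIPLICATIVE**: `((AB)⋆)⁻¹ = (A⋆)⁻¹ (B⋆)⁻¹` (`(AB)⋆ = B⋆A⋆`, `(XY)⁻¹ = Y⁻¹X⁻¹` for square matrices). [cite: Balaban1985Variational, p.307 («Gᶜ-valued fields»; bookkeeping)] -/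
theorem star_inv_mul_star_inv (A B : Matrix (Fin N) (Fin N) ℂ) :
    (star (A * B))⁻¹ = (star A)⁻¹ * (star B)⁻¹ := by
  rw [star_mul, Matrix.mul_inv_rev]

/-- **`θ` COMMUTES WITH THE ADJUGATE** on invertible matrices: `((adj A)⋆)⁻¹ = adj ((A⋆)⁻¹)` (`(adj A)⋆ = adj (A⋆)`, `adj (X⁻¹) = (adj X)⁻¹` for invertible `X`).
[cite: Balaban1985Variational, p.307 (bookkeeping)] -/
theorem adjugate_star_inv (A : Matrix (Fin N) (Fin N) ℂ) (hA : IsUnit A.det) :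
    (star A.adjugate)⁻¹ = ((star A)⁻¹).adjugate := by
  have hAs : IsUnit (star A).det := by
    rw [Matrix.star_eq_conjTranspose, Matrix.det_conjTranspose]
    exact hA.star
  rw [Matrix.star_eq_conjTranspose, Matrix.adjugate_conjTranspose, ← Matrix.star_eq_conjTranspose]
  -- `adj ((A⋆)⁻¹)` is a right inverse of `adj (A⋆)`: `adj (A⋆) · adj ((A⋆)⁻¹) = adj ((A⋆)⁻¹ · A⋆) = adj 1 = 1`
  have h1 : (star A).adjugate * ((star A)⁻¹).adjugate = 1 := by
    rw [← Matrix.adjugate_mul_distrib, Matrix.nonsing_inv_mul _ hAs, Matrix.adjugate_one]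
  exact Matrix.inv_eq_right_inv h1

/-- **`log (X⋆) = (log X)⋆`** on `‖X − 1‖ ≤ 1∕3` (series logarithm (21): `X⋆ = (e^{log X})⋆ = e^{(log X)⋆}` with `‖(log X)⋆‖ = ‖log X‖ < ln 2`, then `log ∘ exp = id`).
[cite: Balaban1985Averaging, (21), (23) p.21] -/
theorem mlog_star {X : Matrix (Fin N) (Fin N) ℂ} (hX : ‖X - 1‖ ≤ 1 / 3) : mlog (star X) = star (mlog X) := by
  letI : NormedAlgebra ℚ (Matrix (Fin N) (Fin N) ℂ) := NormedAlgebra.restrictScalars ℚ ℂ _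
  have hX1 : ‖X - 1‖ < 1 := lt_of_le_of_lt hX (by norm_num)
  have h2 : star X = exp (star (mlog X)) := by rw [← NormedSpace.star_exp, exp_mlog hX1]
  rw [h2]
  exact mlog_exp (by rw [Matrix.star_eq_conjTranspose, Matrix.l2_opNorm_conjTranspose]; exact norm_mlog_lt_log_two hX)

/-- A matrix with `‖X − 1‖ < 1` is invertible (`X = e^{log X}`). [cite: Balaban1985Averaging, (21) p.21 (bookkeeping)] -/
theorem isUnit_det_of_norm_sub_one_lt {X : Matrix (Fin N) (Fin N) ℂ} (hX : ‖X - 1‖ < 1) : IsUnit X.det := by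
  letI : NormedAlgebra ℚ (Matrix (Fin N) (Fin N) ℂ) := NormedAlgebra.restrictScalars ℚ ℂ _
  have h : IsUnit (exp (mlog X)) := NormedSpace.isUnit_exp _
  rw [exp_mlog hX] at h
  exact (Matrix.isUnit_iff_isUnit_det _).1 h

/-- **`log ((X⋆)⁻¹) = −(log X)⋆`** on `‖X − 1‖ ≤ 1∕3` ((0.5)-mechanism `log Y = −log X` for `XY = 1`, at `X⋆`, plus `mlog_star`). [cite: Balaban1987RG1, (0.5) p.253; Balaban1985Averaging, (23) p.21] -/
theorem mlog_star_inv {X : Matrix (Fin N) (Fin N) ℂ} (hX : ‖X - 1‖ ≤ 1 / 3) : mlog ((star X)⁻¹) = -star (mlog X) := by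
  have hXs : ‖star X - 1‖ ≤ 1 / 3 := by rwa [norm_star_sub_one]
  have hunit : IsUnit (star X).det := isUnit_det_of_norm_sub_one_lt (lt_of_le_of_lt hXs (by norm_num))
  rw [mlog_eq_neg_of_mul_eq_one (Matrix.mul_nonsing_inv _ hunit) hXs, mlog_star hX]

/-- **`θ` THROUGH THE `exp[mean log]` OF (0.4)**: `eml{(W_i⋆)⁻¹} = ((eml W)⋆)⁻¹` on the `1∕3`-polydisc (real weight `|I|⁻¹`; `e^{−Y} = (e^{Y})⁻¹`; `(e^{m})⋆ = e^{m⋆}`).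
[cite: Balaban1987RG1, (0.4)–(0.5) p.253] -/
theorem eml_star_inv {ι : Type*} [Fintype ι] {W : ι → Matrix (Fin N) (Fin N) ℂ} (hW : ∀ i, ‖W i - 1‖ ≤ 1 / 3) :
    eml (fun i => (star (W i))⁻¹) = (star (eml W))⁻¹ := by
  letI : NormedAlgebra ℚ (Matrix (Fin N) (Fin N) ℂ) := NormedAlgebra.restrictScalars ℚ ℂ _
  rw [eml_eq_exp, eml_eq_exp]
  have hsum : ∑ i, mlog ((star (W i))⁻¹) = -star (∑ i, mlog (W i)) := by
    rw [star_sum, ← Finset.sum_neg_distrib]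
    exact Finset.sum_congr rfl fun i _ => mlog_star_inv (hW i)
  have hc : star (((Fintype.card ι : ℂ))⁻¹) = ((Fintype.card ι : ℂ))⁻¹ := by simp
  rw [hsum, smul_neg, NormedSpace.star_exp, ← Matrix.exp_neg, star_smul, hc]

end Theta

/-! ### `θ` through the holomorphic walk products, the one-step averaging and the iterate -/

section ThetaAveraging

open NormedSpace (exp)
open ExpMeanLog (eml_eq_exp)
open MatrixLog (mlog)

variable {P : Params} {j : ℕ} {N : ℕ}

/-- `θ` through a holomorphic step matrix (invertible field). [cite: Balaban1985Variational, p.307 (bookkeeping)] -/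
theorem stepMh_theta (V : PBond P j → Matrix (Fin N) (Fin N) ℂ) (hV : ∀ b, IsUnit (V b).det) (s : LStep P j) :
    stepMh (fun b => (star (V b))⁻¹) s = (star (stepMh V s))⁻¹ := by
  unfold stepMh
  split_ifs
  · rfl
  · exact (adjugate_star_inv _ (hV _)).symm

/-- ★ **`θ` THROUGH THE HOLOMORPHIC WALK PRODUCTS**: `holMh (θ ∘ V) γ = θ (holMh V γ)` for invertible fields. [cite: Balaban1985Variational, p.307 («Gᶜ-valued fields»)] -/
theorem holMh_theta (V : PBond P j → Matrix (Fin N) (Fin N) ℂ) (hV : ∀ b, IsUnit (V b).det) :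
    ∀ γ : List (LStep P j), holMh (fun b => (star (V b))⁻¹) γ = (star (holMh V γ))⁻¹
  | [] => by rw [holMh_nil, holMh_nil, star_one, inv_one]
  | s :: γ => by rw [holMh_cons, holMh_cons, star_inv_mul_star_inv, stepMh_theta V hV, holMh_theta V hV γ]

/-- ★★ **`θ` THROUGH THE HOLOMORPHIC AVERAGING (0.4)**: at an invertible field whose loop matrices lie in the `1∕3`-polydisc, `avgMh (θ ∘ V) = θ ∘ avgMh V`.
[cite: Balaban1987RG1, (0.4)–(0.5) p.253; Balaban1985Variational, p.307] -/
theorem avgMh_theta {V : PBond P j → Matrix (Fin N) (Fin N) ℂ} (hV : ∀ b, IsUnit (V b).det)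
    (h : ∀ (c : PBond P (j + 1)) (i : Idx P), ‖loopMh V c i - 1‖ ≤ 1 / 3) :
    avgMh (fun b => (star (V b))⁻¹) = fun c => (star (avgMh V c))⁻¹ := by
  funext c
  show eml (fun i : Idx P => loopMh (fun b => (star (V b))⁻¹) c i) * axialMh (fun b => (star (V b))⁻¹) c =
    (star (eml (fun i : Idx P => loopMh V c i) * axialMh V c))⁻¹
  have hl : (fun i : Idx P => loopMh (fun b => (star (V b))⁻¹) c i) = fun i => (star (loopMh V c i))⁻¹ :=
    funext fun i => holMh_theta V hV _
  rw [hl, eml_star_inv (h c), show axialMh (fun b => (star (V b))⁻¹) c = (star (axialMh V c))⁻¹ from holMh_theta V hV _,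
    star_inv_mul_star_inv]

/-- Invertibility propagates through the holomorphic averaging at such fields: every `avgMh V c` is invertible (`eml` is an exponential; walk products of invertibles).
[cite: Balaban1987RG1, (0.4) p.253 (bookkeeping)] -/
theorem isUnit_det_holMh (V : PBond P j → Matrix (Fin N) (Fin N) ℂ) (hV : ∀ b, IsUnit (V b).det) :
    ∀ γ : List (LStep P j), IsUnit (holMh V γ).det
  | [] => by rw [holMh_nil, Matrix.det_one]; exact isUnit_one
  | s :: γ => by
    rw [holMh_cons, Matrix.det_mul]
    refine IsUnit.mul ?_ (isUnit_det_holMh V hV γ)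
    unfold stepMh
    split_ifs
    · exact hV _
    · rw [Matrix.det_adjugate]; exact (hV _).pow _

/-- Every one-step average of an invertible field is invertible. [cite: Balaban1987RG1, (0.4) p.253 (bookkeeping)] -/
theorem isUnit_det_avgMh (V : PBond P j → Matrix (Fin N) (Fin N) ℂ) (hV : ∀ b, IsUnit (V b).det) (c : PBond P (j + 1)) :
    IsUnit (avgMh V c).det := by
  letI : NormedAlgebra ℚ (Matrix (Fin N) (Fin N) ℂ) := NormedAlgebra.restrictScalars ℚ ℂ _
  show IsUnit (eml (fun i : Idx P => loopMh V c i) * axialMh V c).det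
  rw [Matrix.det_mul]
  refine IsUnit.mul ?_ (isUnit_det_holMh V hV _)
  rw [eml_eq_exp, ← Matrix.isUnit_iff_isUnit_det]
  exact NormedSpace.isUnit_exp _

/-- ★★ **`θ` THROUGH THE HOLOMORPHIC ITERATE**: at an invertible level-`0` field whose iterates have loop matrices in the `1∕3`-polydisc at every level `< k`,
`iterMh k (θ ∘ V) = θ ∘ iterMh k V`. [cite: Balaban1987RG1, (0.21) p.256; Balaban1985Variational, p.307, Prop. 9 p.309] -/
theorem iterMh_theta {V : PBond P 0 → Matrix (Fin N) (Fin N) ℂ} (hV : ∀ b, IsUnit (V b).det) :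
    ∀ k, (∀ j', j' < k → ∀ (c : PBond P (j' + 1)) (i : Idx P), ‖loopMh (iterMh j' V) c i - 1‖ ≤ 1 / 3) →
      iterMh k (fun b => (star (V b))⁻¹) = fun b => (star (iterMh k V b))⁻¹
  | 0, _ => rfl
  | k + 1, h => by
    have hunit : ∀ k', ∀ b, IsUnit (iterMh k' V b).det := by
      intro k'
      induction k' with
      | zero => exact hV
      | succ k' ih => exact fun b => isUnit_det_avgMh _ ih b
    rw [iterMh_succ, iterMh_succ, iterMh_theta hV k fun j' hj' => h j' (Nat.lt_succ_of_lt hj')]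
    exact avgMh_theta (hunit k) (h k (Nat.lt_succ_self k))

end ThetaAveraging


end Literature.MathematicalPhysics.QuantumFieldTheory.Balaban1983to89.B15AveragingHolomorphic

end
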